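import Summits.BirchSwinnertonDyer.Rank1Residual.X2.HidaLimitCongruenceAlgebra
import Summits.BirchSwinnertonDyer.Rank1Residual.X11b.RouteR1IntReceptacle
import Literature.Algebra.Module.QuotientSelfInjective
import HarnessLib

/-!
# Road FF with the receptacle `𝓞_{ℂ_p}⟦T⟧`: PURITY of `Λ_{R₀} = R₀⟦T⟧ → 𝓞_{ℂ_p}⟦T⟧` for every ideal containing a
# power of `p`, and the congruence limit run in `R₀⟦T⟧` from data read in `𝓞_{ℂ_p}⟦T⟧` (item stmt-BirchSwinnertonDyer-20169)

Cell `bsd-stepL` (run/shared/lean/pub/bsd-stepL/), seat `bsd-stepL-imc-p1` (prover g15, 2026-08-28);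
`--supports stmt-BirchSwinnertonDyer-20169 --as helper` (K2 crux `IMCDivAtErratumDataAllR`, Road FF). Theses-free;
THEOREMS ONLY (generic commutative algebra + its instance at `R₀ → 𝓞_{ℂ_p}`); no definition, no named fact, no
`sorry`, no instance.

## Why (design memo `HOME/imc-p1/g15/FSPLIT-DESIGN-20529-imc-p1-g15.md`, §1 and §3 (K1))

The Road-FF transfer (`CongruenceDescent.map_le_span_of_oneSided_congruences_descent_le`, p489585; feeder p495387)
reads the member data — (2.5)_m `Fitt(N_m)·S'_m ⊆ (L_m)` and (c) `(L_m) ⊆ (L^Σ_f) + (p^m)` — in a receptacle `S'_m` that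
is FAITHFULLY FLAT over `R₀⟦T⟧`, and uses faithful flatness ONLY to contract the ideal `(L^Σ_f) + (p^m)` back to
`R₀⟦T⟧` (`Ideal.comap_map_eq_self_of_faithfullyFlat`), where Krull's intersection theorem runs. To host a member's
`p`-adic `L`-function as a DEFINITE element one wants the receptacle `𝓞_{ℂ_p}⟦T⟧` (a domain containing `R₀` and
every `𝒪_m`; tree `R1.IsBDPLFunctionInt`, `IntSeries.HasValueAt`), which is not Noetherian and whose flatness over
`R₀⟦T⟧` is not in the tree. This file proves that NO flatness is needed: **`R₀⟦T⟧ → 𝓞_{ℂ_p}⟦T⟧` contracts every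
ideal containing `p^m`** (`comap_map_unrToCpInt_eq_of_C_pow_mem`), because
* `R₀ ∩ p^m 𝓞_{ℂ_p} = p^m R₀` (`p` is a uniformiser of the DVR `R₀`: tree `exists_associated_pow_natCast_p`), and
* `R₀/p^m` is SELF-INJECTIVE (the tree's `Literature.Algebra.Module.quotient_baer`: Baer's criterion for the
  quotient of a PID by a non-zero element, [Hungerford1974] IV §6 Ex. 7 (d)), so `R₀/p^m ↪ 𝓞_{ℂ_p}/p^m` has an
  `R₀/p^m`-linear retraction (`exists_retraction_quotient_of_injective`, generic: PID `A`, `a ≠ 0`, `A/(a) → B/(a)B`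
  injective), which extends coefficientwise to an `(R₀/p^m)⟦T⟧`-linear retraction of `(𝓞_{ℂ_p}/p^m)⟦T⟧`, and a ring extension
  with a linear retraction is PURE on power series (`comap_map_le_of_retraction`); the case of a retraction only
  modulo `𝔞` gives purity for the ideals containing `𝔞⟦T⟧` (`comap_map_le_of_retraction_quotient`,
  `comap_map_eq_of_quotient_injective` — generic), and `unrToCpInt_quotient_injective` is the `R₀` instance.
Consequences: `I·𝓞_{ℂ_p}⟦T⟧ ⊆ (L)·𝓞_{ℂ_p}⟦T⟧ + (p^m) ↔ I ⊆ (L) + (p^m)` (`map_unrToCpInt_le_span_sup_pow_iff`) and the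
CONGRUENCE LIMIT READ IN `𝓞_{ℂ_p}⟦T⟧`: `(∀ m ≥ 1, I·𝓞_{ℂ_p}⟦T⟧ ⊆ (L)·𝓞_{ℂ_p}⟦T⟧ + (p^m)) → I ⊆ (L)` in `R₀⟦T⟧`
(`le_span_of_forall_map_unrToCpInt_le_sup_pow`; Krull in the Noetherian local ring `R₀⟦T⟧`, tree
`CongruenceLimit.iInf_sup_pow_eq_self` + `span_C_p_le_jacobson_unrSeries`). The tree's VALUE-descent
`X11b.ideal_map_toUnr_le_span_iff` (multr1-p2) is the case `m = ∞` (principal ideals); the ideals `(L) + (p^m)` are not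
principal and need the present argument.

HONEST FRAMING: pure algebra; nothing about any curve, Selmer group or `L`-function is asserted; BSD is proved for no
pair; no census number moves (T7).

References: [Lam1999] T. Y. Lam, *Lectures on Modules and Rings*, GTM 189, (3.7) Baer's criterion, (3.13)
(quotients of PIDs by non-zero elements are self-injective), (4.92)–(4.93) (pure extensions; split injections are
pure); [Hungerford1974] IV §6 Ex. 7 (d) (tree `Literature.Algebra.Module.quotient_baer`); [StacksProject, Tag 05GI]
(Krull's intersection theorem); [Castella2018] §3 (arXiv:1704.06608 p. 9: `R₀`, `Λ_{R₀}`);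
[Castella2018Erratum] proof of Thm. 1.1 (p. 4: the congruence transfer this serves).
-/

set_option autoImplicit false

noncomputable section

open scoped Classical

open PowerSeries
open Literature.NumberTheory.EllipticCurves
open Literature.NumberTheory.LFunctions.Dwork (norm_natCast_p_padicComplex)
open Summit.BirchSwinnertonDyer.Rank1Residual.X11b.Halves
open Summit.BirchSwinnertonDyer.Rank1Residual.X2.HidaLimitAlgebra

namespace Summit.BirchSwinnertonDyer.Rank1Residual.X11b.ReceptaclePurity

universe u v

/-! ### §1 Power series along a ring map with a linear retraction: purity -/

section Generic

variable {A : Type u} {B : Type v} [CommRing A] [CommRing B]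

/-- A retraction `r` of `f : A → B`, applied coefficientwise, retracts `A⟦T⟧ → B⟦T⟧`:
`∑ r(f(xₙ)) Tⁿ = ∑ xₙ Tⁿ`. [folklore] -/
theorem mk_apply_coeff_map (f : A →+* B) (r : B →+ A) (hr : ∀ a, r (f a) = a) (x : PowerSeries A) :
    (PowerSeries.mk fun n => r (PowerSeries.coeff n (PowerSeries.map f x))) = x := by
  ext n; simp [hr]

/-- Coefficientwise application of an additive map is additive. [folklore] -/
theorem mk_apply_coeff_add (r : B →+ A) (y z : PowerSeries B) :
    (PowerSeries.mk fun n => r (PowerSeries.coeff n (y + z))) =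
      (PowerSeries.mk fun n => r (PowerSeries.coeff n y)) + PowerSeries.mk fun n => r (PowerSeries.coeff n z) := by
  ext n; simp

/-- An `A`-LINEAR retraction, applied coefficientwise, is `A⟦T⟧`-linear: `r(y · f(x)) = r(y) · x` (Cauchy
product). [folklore] -/
theorem mk_apply_coeff_mul_map (f : A →+* B) (r : B →+ A) (hr : ∀ b a, r (b * f a) = r b * a)
    (y : PowerSeries B) (x : PowerSeries A) :
    (PowerSeries.mk fun n => r (PowerSeries.coeff n (y * PowerSeries.map f x))) =
      (PowerSeries.mk fun n => r (PowerSeries.coeff n y)) * x := by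
  ext n
  simp only [PowerSeries.coeff_mk, PowerSeries.coeff_mul, PowerSeries.coeff_map, map_sum, hr]

/-- **PURITY of `A⟦T⟧ → B⟦T⟧` along a ring map with an `A`-linear retraction**: every ideal `J` of `A⟦T⟧` is
contracted, `(J·B⟦T⟧) ∩ A⟦T⟧ ⊆ J`. Proof: for `y` in `J·B⟦T⟧` and every `b ∈ B⟦T⟧`, `r(b·y) ∈ J` coefficientwise
(induction over the span; `r(b·f(j)) = r(b)·j`); take `b = 1`, `y = f(x)`.
[cite: Lam1999, (4.92)–(4.93) (pure submodules ∕ pure extensions; a split injection is pure)] -/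
theorem comap_map_le_of_retraction (f : A →+* B) (r : B →+ A) (hr1 : ∀ a, r (f a) = a)
    (hr2 : ∀ b a, r (b * f a) = r b * a) (J : Ideal (PowerSeries A)) :
    (J.map (PowerSeries.map f)).comap (PowerSeries.map f) ≤ J := by
  intro x hx
  rw [Ideal.mem_comap] at hx
  have key : ∀ y ∈ J.map (PowerSeries.map f), ∀ b : PowerSeries B,
      (PowerSeries.mk fun n => r (PowerSeries.coeff n (b * y))) ∈ J := by
    intro y hy
    refine Submodule.span_induction
      (p := fun y _ => ∀ b : PowerSeries B, (PowerSeries.mk fun n => r (PowerSeries.coeff n (b * y))) ∈ J)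
      ?_ ?_ ?_ ?_ hy
    · rintro _ ⟨j, hj, rfl⟩ b
      rw [mk_apply_coeff_mul_map f r hr2]
      exact J.mul_mem_left _ hj
    · intro b
      simp only [mul_zero, map_zero]
      exact_mod_cast J.zero_mem
    · intro y z _ _ hy hz b
      rw [mul_add, mk_apply_coeff_add]
      exact J.add_mem (hy b) (hz b)
    · intro c y _ hy b
      rw [smul_eq_mul, ← mul_assoc]
      exact hy (b * c)
  have h := key _ hx 1
  rwa [one_mul, mk_apply_coeff_map f r hr1] at h

/-- Equality form of `comap_map_le_of_retraction`. [cite: Lam1999, (4.92)–(4.93)] -/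
theorem comap_map_eq_of_retraction (f : A →+* B) (r : B →+ A) (hr1 : ∀ a, r (f a) = a)
    (hr2 : ∀ b a, r (b * f a) = r b * a) (J : Ideal (PowerSeries A)) :
    (J.map (PowerSeries.map f)).comap (PowerSeries.map f) = J :=
  le_antisymm (comap_map_le_of_retraction f r hr1 hr2 J) Ideal.le_comap_map

/-- **Purity modulo `𝔞`**: if the induced map `A/𝔞 → B/𝔞B` has an `A/𝔞`-linear retraction, every ideal `J` of
`A⟦T⟧` containing the series with coefficients in `𝔞` is contracted from `B⟦T⟧`. Proof: push to the quotients,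
contract there (`comap_map_le_of_retraction`), lift along the surjection `A⟦T⟧ → (A/𝔞)⟦T⟧`. [cite: Lam1999, (4.92)–(4.93)] -/
theorem comap_map_le_of_retraction_quotient (f : A →+* B) (𝔞 : Ideal A)
    (fbar : A ⧸ 𝔞 →+* B ⧸ 𝔞.map f)
    (hfbar : ∀ a, fbar (Ideal.Quotient.mk 𝔞 a) = Ideal.Quotient.mk (𝔞.map f) (f a))
    (r : B ⧸ 𝔞.map f →+ A ⧸ 𝔞) (hr1 : ∀ a, r (fbar a) = a) (hr2 : ∀ b a, r (b * fbar a) = r b * a)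
    (J : Ideal (PowerSeries A)) (hJ : ∀ x : PowerSeries A, (∀ n, PowerSeries.coeff n x ∈ 𝔞) → x ∈ J) :
    (J.map (PowerSeries.map f)).comap (PowerSeries.map f) ≤ J := by
  intro x hx
  rw [Ideal.mem_comap] at hx
  set πA : PowerSeries A →+* PowerSeries (A ⧸ 𝔞) := PowerSeries.map (Ideal.Quotient.mk 𝔞) with hπA
  set πB : PowerSeries B →+* PowerSeries (B ⧸ 𝔞.map f) :=
    PowerSeries.map (Ideal.Quotient.mk (𝔞.map f)) with hπB
  have hsq : πB.comp (PowerSeries.map f) = (PowerSeries.map fbar).comp πA := by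
    rw [hπA, hπB, ← PowerSeries.map_comp, ← PowerSeries.map_comp]
    congr 1
    exact RingHom.ext fun a => (hfbar a).symm
  have h1 : πB (PowerSeries.map f x) ∈ (J.map (PowerSeries.map f)).map πB := Ideal.mem_map_of_mem _ hx
  rw [Ideal.map_map, hsq, ← Ideal.map_map] at h1
  have h1' : PowerSeries.map fbar (πA x) ∈ (J.map πA).map (PowerSeries.map fbar) := by
    have : πB (PowerSeries.map f x) = PowerSeries.map fbar (πA x) := by
      rw [← RingHom.comp_apply, hsq, RingHom.comp_apply]
    rwa [this] at h1
  have h2 : πA x ∈ J.map πA :=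
    comap_map_le_of_retraction fbar r hr1 hr2 (J.map πA) (by rwa [Ideal.mem_comap])
  have hsurj : Function.Surjective πA := PowerSeries.map_surjective _ Ideal.Quotient.mk_surjective
  obtain ⟨j, hj, hjx⟩ := (Ideal.mem_map_iff_of_surjective πA hsurj).1 h2
  have hdiff : x - j ∈ J := by
    refine hJ _ fun n => ?_
    have h0 : PowerSeries.coeff n (πA (x - j)) = 0 := by rw [map_sub, hjx, sub_self, map_zero]
    rwa [hπA, PowerSeries.coeff_map, Ideal.Quotient.eq_zero_iff_mem] at h0
  have := J.add_mem hdiff hj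
  rwa [sub_add_cancel] at this

end Generic

/-! ### §2 From injectivity modulo `(a)` to a retraction modulo `(a)` (`R/(a)` is self-injective) and purity -/

section Baer

variable {R : Type u} [CommRing R] [IsDomain R] [IsPrincipalIdealRing R]

/-- **A retraction modulo `(a)` from injectivity modulo `(a)`** (`A` a PID, `a ≠ 0`): if `A/(a) → B/(a)B` is
injective, it has an `A/(a)`-linear retraction (self-injectivity of `A/(a)`), stated in ring-map currency
(`r (f̄ x) = x`, `r (b · f̄ x) = r b · x`). [cite: Lam1999, (3.13) with (3.7) and (4.92)–(4.93)] -/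
theorem exists_retraction_quotient_of_injective {B : Type v} [CommRing B] (f : R →+* B) {a : R} (ha : a ≠ 0)
    (hinj : ∀ x : R, f x ∈ (Ideal.span {a}).map f → x ∈ Ideal.span {a}) :
    ∃ r : B ⧸ (Ideal.span {a}).map f →+ R ⧸ Ideal.span {a},
      (∀ x, r (Ideal.quotientMap _ f Ideal.le_comap_map x) = x) ∧
      (∀ b x, r (b * Ideal.quotientMap _ f Ideal.le_comap_map x) = r b * x) := by
  set 𝔞 : Ideal R := Ideal.span {a} with h𝔞
  set fbar : R ⧸ 𝔞 →+* B ⧸ 𝔞.map f := Ideal.quotientMap _ f Ideal.le_comap_map with hfbar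
  -- `B/(a)B` as an algebra (hence a module) over `R/(a)` through `fbar`
  letI : Algebra (R ⧸ 𝔞) (B ⧸ 𝔞.map f) := fbar.toAlgebra
  have hsmul : ∀ (x : R ⧸ 𝔞) (b : B ⧸ 𝔞.map f), x • b = fbar x * b := fun x b => Algebra.smul_def x b
  set i : (R ⧸ 𝔞) →ₗ[R ⧸ 𝔞] (B ⧸ 𝔞.map f) :=
    { toFun := fbar
      map_add' := fun x y => map_add fbar x y
      map_smul' := fun x y => by rw [smul_eq_mul, map_mul, RingHom.id_apply, hsmul] } with hi
  have hinj' : Function.Injective i := by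
    rw [injective_iff_map_eq_zero]
    intro x hx
    obtain ⟨x₀, rfl⟩ := Ideal.Quotient.mk_surjective x
    change fbar (Ideal.Quotient.mk 𝔞 x₀) = 0 at hx
    rw [hfbar, Ideal.quotientMap_mk, Ideal.Quotient.eq_zero_iff_mem] at hx
    exact Ideal.Quotient.eq_zero_iff_mem.mpr (hinj x₀ hx)
  obtain ⟨h, hh⟩ := (Literature.Algebra.Module.quotient_baer ha).extension_property i hinj' LinearMap.id
  refine ⟨h.toAddMonoidHom, fun x => ?_, fun b x => ?_⟩
  · exact LinearMap.congr_fun hh x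
  · change h (b * fbar x) = h b * x
    rw [mul_comm b, ← hsmul, map_smul, smul_eq_mul, mul_comm]

/-- **PURITY modulo `(a)` from injectivity modulo `(a)`**: for `A` a PID, `a ≠ 0` and `f : A → B` with `A/(a) → B/(a)B`
injective, every ideal `J ∋ C(a)` of `A⟦T⟧` is contracted from `B⟦T⟧`. [cite: Lam1999, (3.13) with (3.7) and (4.92)–(4.93)] -/
theorem comap_map_eq_of_quotient_injective {B : Type v} [CommRing B] (f : R →+* B) {a : R} (ha : a ≠ 0)
    (hinj : ∀ x : R, f x ∈ (Ideal.span {a}).map f → x ∈ Ideal.span {a})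
    (J : Ideal (PowerSeries R)) (hJ : (PowerSeries.C a : PowerSeries R) ∈ J) :
    (J.map (PowerSeries.map f)).comap (PowerSeries.map f) = J := by
  refine le_antisymm ?_ Ideal.le_comap_map
  obtain ⟨r, hr1, hr2⟩ := exists_retraction_quotient_of_injective f ha hinj
  refine comap_map_le_of_retraction_quotient f (Ideal.span {a}) (Ideal.quotientMap _ f Ideal.le_comap_map)
    (fun x => Ideal.quotientMap_mk) r hr1 hr2 J ?_
  intro x hx
  -- every coefficient divisible by `a` ⟹ `x = C(a) · x'`
  choose c hc using fun n => Ideal.mem_span_singleton'.1 (hx n)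
  have hx' : x = PowerSeries.C a * PowerSeries.mk c := by
    ext n
    rw [mul_comm, PowerSeries.coeff_mul_C, PowerSeries.coeff_mk, hc]
  rw [hx']
  exact J.mul_mem_right _ hJ

end Baer

/-! ### §3 The instance `R₀ → 𝓞_{ℂ_p}`, `𝔞 = (p^m)` -/

section Unr

variable {p : ℕ} [hp : Fact p.Prime]

/-- **`R₀ ∩ p^m 𝓞_{ℂ_p} = p^m R₀`**: if `x ∈ R₀` is divisible by `p^m` in `𝓞_{ℂ_p}` then already in `R₀` (`x = p^n u`
with `u ∈ R₀^×`, and `‖x‖ ≤ p^{−m}` forces `n ≥ m`). [cite: Castella2018, §3 (arXiv:1704.06608 p. 9)] -/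
theorem mem_span_pow_of_unrToCpInt_mem (m : ℕ) {x : unrIntegers p}
    (hx : R1.unrToCpInt p x ∈ Ideal.span {((p : ℕ) : 𝓞_ℂ_[p]) ^ m}) :
    x ∈ Ideal.span {((p : ℕ) : unrIntegers p) ^ m} := by
  have hp' : p.Prime := hp.out
  rcases eq_or_ne x 0 with rfl | hx0
  · exact Ideal.zero_mem _
  obtain ⟨y, hy⟩ := Ideal.mem_span_singleton'.1 hx
  have hpR : (0 : ℝ) < (p : ℝ)⁻¹ := inv_pos.mpr (by exact_mod_cast hp'.pos)
  have hpR1 : (p : ℝ)⁻¹ < 1 := inv_lt_one_of_one_lt₀ (by exact_mod_cast hp'.one_lt)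
  -- `‖x‖ ≤ p^{-m}`
  have hnorm : ‖(x : ℂ_[p])‖ ≤ (p : ℝ)⁻¹ ^ m := by
    have hxy : (x : ℂ_[p]) = ((y : 𝓞_ℂ_[p]) : ℂ_[p]) * (p : ℂ_[p]) ^ m := by
      have := congrArg (fun t : 𝓞_ℂ_[p] => (t : ℂ_[p])) hy
      simpa using this.symm
    rw [hxy, norm_mul, norm_pow, norm_natCast_p_padicComplex]
    exact mul_le_of_le_one_left (pow_nonneg hpR.le _) (R1.norm_coe_padicComplexInt_le_one p y)
  -- `x = p^n · u`
  obtain ⟨n, u, hu⟩ := exists_associated_pow_natCast_p hx0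
  have hn : ‖(x : ℂ_[p])‖ = (p : ℝ)⁻¹ ^ n := by
    have hu1 : ‖((u : unrIntegers p) : ℂ_[p])‖ = 1 := (unrIntegers.isUnit_iff_norm_eq_one _).mp u.isUnit
    rw [← hu]
    push_cast
    rw [norm_mul, norm_pow, norm_natCast_p_padicComplex, hu1, mul_one]
  have hmn : m ≤ n := le_of_not_gt fun h => by
    have := pow_lt_pow_right_of_lt_one₀ hpR hpR1 h
    rw [← hn] at this
    exact (lt_irrefl _) (this.trans_le hnorm)
  rw [Ideal.mem_span_singleton]
  refine ⟨((p : ℕ) : unrIntegers p) ^ (n - m) * u, ?_⟩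
  rw [← mul_assoc, ← pow_add, Nat.add_sub_cancel' hmn, hu]

/-- The image of `(p^m) ⊆ R₀` in `𝓞_{ℂ_p}` is `(p^m)`. [folklore] -/
theorem map_unrToCpInt_span_pow (m : ℕ) :
    (Ideal.span {((p : ℕ) : unrIntegers p) ^ m}).map (R1.unrToCpInt p) =
      Ideal.span {((p : ℕ) : 𝓞_ℂ_[p]) ^ m} := by
  rw [Ideal.map_span, Set.image_singleton, map_pow, map_natCast]

/-- `R₀/p^m → 𝓞_{ℂ_p}/p^m` is injective, in the currency of `comap_map_eq_of_quotient_injective`.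
[cite: Castella2018, §3 (arXiv:1704.06608 p. 9)] -/
theorem unrToCpInt_quotient_injective (m : ℕ) (x : unrIntegers p)
    (hx : R1.unrToCpInt p x ∈ (Ideal.span {((p : ℕ) : unrIntegers p) ^ m}).map (R1.unrToCpInt p)) :
    x ∈ Ideal.span {((p : ℕ) : unrIntegers p) ^ m} := by
  rw [map_unrToCpInt_span_pow] at hx
  exact mem_span_pow_of_unrToCpInt_mem m hx

/-- **PURITY of `R₀⟦T⟧ → 𝓞_{ℂ_p}⟦T⟧` for ideals containing a power of `p`**: if `p^m ∈ J` then
`(J·𝓞_{ℂ_p}⟦T⟧) ∩ R₀⟦T⟧ = J`. [cite: Lam1999, (3.13) with (3.7) and (4.92)–(4.93)] [cite: Castella2018, §3 (arXiv:1704.06608 p. 9)] -/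
theorem comap_map_unrToCpInt_eq_of_C_pow_mem (J : Ideal (UnrSeries p)) {m : ℕ}
    (hJ : (PowerSeries.C (((p : ℕ) : unrIntegers p) ^ m) : UnrSeries p) ∈ J) :
    (J.map (PowerSeries.map (R1.unrToCpInt p))).comap (PowerSeries.map (R1.unrToCpInt p)) = J := by
  haveI := isDiscreteValuationRing_unrIntegers (p := p)
  exact comap_map_eq_of_quotient_injective (R1.unrToCpInt p)
    (pow_ne_zero _ (irreducible_natCast_p (p := p)).ne_zero) (unrToCpInt_quotient_injective m) J hJ

/-- The image of `(p)^m ⊆ R₀⟦T⟧` in `𝓞_{ℂ_p}⟦T⟧`, spelled with `C`. [folklore] -/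
theorem map_span_C_pow (m : ℕ) :
    ((Ideal.span {(PowerSeries.C ((p : ℕ) : unrIntegers p) : UnrSeries p)}) ^ m).map
        (PowerSeries.map (R1.unrToCpInt p)) =
      (Ideal.span {(PowerSeries.C ((p : ℕ) : 𝓞_ℂ_[p]) : PowerSeries 𝓞_ℂ_[p])}) ^ m := by
  rw [Ideal.map_pow, Ideal.map_span, Set.image_singleton, PowerSeries.map_C, map_natCast]

/-- **Reading `I ⊆ (L) + (p)^m` in `𝓞_{ℂ_p}⟦T⟧` is the same as in `R₀⟦T⟧`** (`I`, `L` over `R₀`).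
[cite: Lam1999, (3.13) with (3.7) and (4.92)–(4.93)] -/
theorem map_unrToCpInt_le_span_sup_pow_iff (I : Ideal (UnrSeries p)) (L : UnrSeries p) (m : ℕ) :
    I.map (PowerSeries.map (R1.unrToCpInt p)) ≤
        Ideal.span {PowerSeries.map (R1.unrToCpInt p) L} ⊔
          (Ideal.span {(PowerSeries.C ((p : ℕ) : 𝓞_ℂ_[p]) : PowerSeries 𝓞_ℂ_[p])}) ^ m ↔
      I ≤ Ideal.span {L} ⊔ (Ideal.span {(PowerSeries.C ((p : ℕ) : unrIntegers p) : UnrSeries p)}) ^ m := by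
  set φ := PowerSeries.map (R1.unrToCpInt p) with hφ
  have himg : (Ideal.span {L} ⊔ (Ideal.span {(PowerSeries.C ((p : ℕ) : unrIntegers p) : UnrSeries p)}) ^ m).map φ
      = Ideal.span {φ L} ⊔ (Ideal.span {(PowerSeries.C ((p : ℕ) : 𝓞_ℂ_[p]) : PowerSeries 𝓞_ℂ_[p])}) ^ m := by
    rw [Ideal.map_sup, Ideal.map_span, Set.image_singleton, hφ, map_span_C_pow]
  constructor
  · intro h
    have hmem : (PowerSeries.C (((p : ℕ) : unrIntegers p) ^ m) : UnrSeries p) ∈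
        Ideal.span {L} ⊔ (Ideal.span {(PowerSeries.C ((p : ℕ) : unrIntegers p) : UnrSeries p)}) ^ m := by
      refine Ideal.mem_sup_right ?_
      rw [Ideal.span_singleton_pow, map_pow]
      exact Ideal.mem_span_singleton_self _
    rw [← comap_map_unrToCpInt_eq_of_C_pow_mem _ hmem]
    exact Ideal.le_comap_map.trans (Ideal.comap_mono (h.trans himg.ge))
  · intro h
    rw [← himg]
    exact Ideal.map_mono h

/-- **The congruence limit READ IN `𝓞_{ℂ_p}⟦T⟧`**: if `I·𝓞_{ℂ_p}⟦T⟧ ⊆ (L)·𝓞_{ℂ_p}⟦T⟧ + (p)^m` for every `m ≥ 1`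
(`I`, `L` over `R₀`), then `I ⊆ (L)` in `R₀⟦T⟧` — contract each inclusion (purity) and apply Krull's intersection theorem
in the Noetherian local ring `R₀⟦T⟧` (`(p) ⊆ Jac`). [cite: StacksProject, Tag 05GI] [cite: Lam1999, (3.13) with (3.7) and (4.92)–(4.93)] -/
theorem le_span_of_forall_map_unrToCpInt_le_sup_pow (I : Ideal (UnrSeries p)) (L : UnrSeries p)
    (h : ∀ m : ℕ, 1 ≤ m →
      I.map (PowerSeries.map (R1.unrToCpInt p)) ≤
        Ideal.span {PowerSeries.map (R1.unrToCpInt p) L} ⊔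
          (Ideal.span {(PowerSeries.C ((p : ℕ) : 𝓞_ℂ_[p]) : PowerSeries 𝓞_ℂ_[p])}) ^ m) :
    I ≤ Ideal.span {L} := by
  haveI := isNoetherianRing_unrSeries (p := p)
  rw [← CongruenceLimit.iInf_sup_pow_eq_self
    (Ideal.span {(PowerSeries.C ((p : ℕ) : unrIntegers p) : UnrSeries p)}) (Ideal.span {L})
    span_C_p_le_jacobson_unrSeries]
  refine le_iInf fun m => ?_
  rcases Nat.eq_zero_or_pos m with rfl | hm
  · rw [pow_zero, Ideal.one_eq_top, sup_top_eq]; exact le_top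
  · exact (map_unrToCpInt_le_span_sup_pow_iff I L m).1 (h m hm)

/-- The same limit with the member-style hypothesis: membership of `I·𝓞_{ℂ_p}⟦T⟧` in `(L)·𝓞_{ℂ_p}⟦T⟧ + (p^m)` with
`p^m` spelled as the constant `C(p^m)` of `𝓞_{ℂ_p}⟦T⟧`. [cite: StacksProject, Tag 05GI] -/
theorem le_span_of_forall_map_unrToCpInt_le_sup_C_pow (I : Ideal (UnrSeries p)) (L : UnrSeries p)
    (h : ∀ m : ℕ, 1 ≤ m →
      I.map (PowerSeries.map (R1.unrToCpInt p)) ≤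
        Ideal.span {PowerSeries.map (R1.unrToCpInt p) L} ⊔
          Ideal.span {(PowerSeries.C (((p : ℕ) : 𝓞_ℂ_[p]) ^ m) : PowerSeries 𝓞_ℂ_[p])}) :
    I ≤ Ideal.span {L} := by
  refine le_span_of_forall_map_unrToCpInt_le_sup_pow I L fun m hm => ?_
  rw [Ideal.span_singleton_pow, ← map_pow]
  exact h m hm

end Unr

end Summit.BirchSwinnertonDyer.Rank1Residual.X11b.ReceptaclePurity

end
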